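import Mathlib
import Summits.ValiantsHypothesis.ValiantsHypothesis.Theorems.NewtonUnitEquationsDissociatedUniformQuasiPoly
import Summits.ValiantsHypothesis.ValiantsHypothesis.Theorems.NewtonUnitEquationsDissociatedUniformStubCellDecomposition
import Summits.ValiantsHypothesis.ValiantsHypothesis.Theorems.NewtonUnitEquationsDissociatedUniformStubColoredNovelty
import Summits.ValiantsHypothesis.ValiantsHypothesis.Theorems.NewtonUnitEquationsDissociatedUniformStubTorusDepth
import Summits.ValiantsHypothesis.ValiantsHypothesis.Theorems.NewtonUnitEquationsDissociatedUniformStubTorusCrossNovelty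
import Summits.ValiantsHypothesis.ValiantsHypothesis.Theorems.NewtonUnitEquationsDissociatedUniformStubSubframeCount

/-!
# The torus stratum of crux `DissociatedUniform` has exponent `O(log k)` — I: the per-cell reduction to `≤ k²` coordinates

Line `greedy-basis-shadow` of crux stmt-ValiantsHypothesis-5905 `NewtonUnitEquations.DissociatedUniform`, lead c6 by-product.

**Theorem (`torusLogK`).**  Let `A : Fin m → Finset ℕ²` be a dissociated frame with `|A j| ≤ t`, `supp f i j ⊆ A j`, and
assume the frame is a TORUS frame: no coefficient of a letter of the alphabet vanishes, `coeff l (f i j) ≠ 0` for all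
`l ∈ A j` (designs and general-position tensors are both of this kind; what is excluded are structural zeros = alive
patterns).  Then the Newton polygon of `Σ_{i<k} Π_{j<m} f i j` has at most
`2·(((m t²)² + 1)·Q(k) + (m t²)²·k) + 2k + 1` vertices, `Q(k) = (k² + 3)·(8(k+2)³)^⌈log₂ k²⌉`, i.e.
`poly(m, t) · k^O(log k)`: on torus frames the exponent of Theorem Q (`dissociated_quasiPoly`,
`(t+2)(8(k+2)³)^⌈log₂ m⌉`) may be taken logarithmic in `k` instead of `m`; in particular the count is polynomial in
`(m, t)` whenever `k ≤ 2^O(√log m)`.  Crux-shaped form: `#vert ≤ (k·m·t + 2)^(20·⌈log₂ k⌉ + 9)` (`torusLogK_cruxShape`).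

**Mechanism (new): per cell, `m` reduces to `≤ k²` coordinates.**  In a cell of a chart (constant signs of all
pair-of-pairs letter comparisons; tree `CellDecomposition`) the letterwise top word `τ` and the order of all demotion
weights are frozen.  A greedy word `a` of the cell (i) differs from `τ` in `≤ k − 1` coordinates (`stub_torusDepth`, the
annihilating product functional), and (ii) each of its demotions `(j, a j)` has a coefficient-ratio vector that is NOT
in the span of the ratio vectors of the lighter demotions on `j` or on coordinates where `a` is at the top
(`stub_torusCrossNovelty`).  Hence every demotion used by a greedy word is an `s`-pool element, `s = k − 2`, of the
weighted colored family of all ratio vectors (colors = coordinates), and by the COLORED NOVELTY LEMMA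
(`stub_coloredNovelty`: at most `(s+1)·k` pool elements — Vandermonde lift) all greedy words of the cell live on a
sub-box with `≤ (k−1)k` free coordinates and `≤ (k−1)k + 1` letters per coordinate; they embed into the frame shadow of
that sub-frame (`stub_subframeCount`), which Theorem Q bounds.  Cells and charts are then summed exactly as in
`stub_cellDecomposition`.
-/

set_option linter.dupNamespace false

noncomputable section

open scoped BigOperators

namespace Summit.ValiantsHypothesis.ValiantsHypothesis.Theorems.NewtonUnitEquationsDissociatedUniform

namespace TorusLogK

variable {k m : ℕ}

/-- Heights of the chart `ε X + λ Y` are additive over the letters of a word. -/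
theorem hgt_eq_sum (ε lam : ℝ) (b : Fin m → (Fin 2 →₀ ℕ)) :
    ε * QuasiPoly.Xf b + lam * QuasiPoly.Yf b = ∑ j, (ε * ((b j 0 : ℕ) : ℝ) + lam * ((b j 1 : ℕ) : ℝ)) := by
  simp only [QuasiPoly.Xf, QuasiPoly.Yf, Finsupp.coe_finsetSum, Finset.sum_apply, Nat.cast_sum, Finset.mul_sum,
    Finset.sum_add_distrib]

/-- Height of a single-letter update of a word. -/
theorem hgt_update (ε lam : ℝ) (b : Fin m → (Fin 2 →₀ ℕ)) (j : Fin m) (l : Fin 2 →₀ ℕ) :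
    ε * QuasiPoly.Xf (Function.update b j l) + lam * QuasiPoly.Yf (Function.update b j l) =
      (ε * QuasiPoly.Xf b + lam * QuasiPoly.Yf b) - (ε * ((b j 0 : ℕ) : ℝ) + lam * ((b j 1 : ℕ) : ℝ)) +
        (ε * ((l 0 : ℕ) : ℝ) + lam * ((l 1 : ℕ) : ℝ)) := by
  classical
  rw [hgt_eq_sum, hgt_eq_sum]
  have h1 : ∑ x, (ε * (((Function.update b j l x) 0 : ℕ) : ℝ) + lam * (((Function.update b j l x) 1 : ℕ) : ℝ)) =
      ∑ x, Function.update (fun x => ε * ((b x 0 : ℕ) : ℝ) + lam * ((b x 1 : ℕ) : ℝ)) j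
        (ε * ((l 0 : ℕ) : ℝ) + lam * ((l 1 : ℕ) : ℝ)) x := by
    refine Finset.sum_congr rfl fun x _ => ?_
    by_cases hx : x = j
    · subst hx; simp
    · simp [Function.update_of_ne hx]
  rw [h1, Finset.sum_update_of_mem (Finset.mem_univ j), Finset.sdiff_singleton_eq_erase]
  have h2 := Finset.add_sum_erase Finset.univ (fun x => ε * ((b x 0 : ℕ) : ℝ) + lam * ((b x 1 : ℕ) : ℝ))
    (Finset.mem_univ j)
  linarith

/-- **Per-cell bound on torus frames.**  On a set `Λ` of parameters of the chart `ε X + λ Y` on which every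
pair-of-pairs letter comparison has constant strict signs (a cell), the greedy words met at injective parameters number
at most `(k² + 3)·(8(k+2)³)^⌈log₂ k²⌉`. -/
theorem perCell (k m : ℕ) (A : Fin m → Finset (Fin 2 →₀ ℕ)) (f : Fin k → Fin m → MvPolynomial (Fin 2) ℂ)
    (htorus : ∀ i j, ∀ l ∈ A j, (f i j).coeff l ≠ 0) (ε : ℝ) (Λ : Set ℝ)
    (hcell : ∀ (j j' : Fin m), ∀ l₁ ∈ A j, ∀ l₂ ∈ A j, ∀ l₃ ∈ A j', ∀ l₄ ∈ A j', ∀ lam ∈ Λ, ∀ lam' ∈ Λ,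
      ((ε * ((((l₁ 0 : ℕ) : ℝ)) - (((l₂ 0 : ℕ) : ℝ)) - (((l₃ 0 : ℕ) : ℝ)) + (((l₄ 0 : ℕ) : ℝ))) +
          lam * ((((l₁ 1 : ℕ) : ℝ)) - (((l₂ 1 : ℕ) : ℝ)) - (((l₃ 1 : ℕ) : ℝ)) + (((l₄ 1 : ℕ) : ℝ))) < 0 ↔
        ε * ((((l₁ 0 : ℕ) : ℝ)) - (((l₂ 0 : ℕ) : ℝ)) - (((l₃ 0 : ℕ) : ℝ)) + (((l₄ 0 : ℕ) : ℝ))) +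
          lam' * ((((l₁ 1 : ℕ) : ℝ)) - (((l₂ 1 : ℕ) : ℝ)) - (((l₃ 1 : ℕ) : ℝ)) + (((l₄ 1 : ℕ) : ℝ))) < 0) ∧
      (0 < ε * ((((l₁ 0 : ℕ) : ℝ)) - (((l₂ 0 : ℕ) : ℝ)) - (((l₃ 0 : ℕ) : ℝ)) + (((l₄ 0 : ℕ) : ℝ))) +
          lam * ((((l₁ 1 : ℕ) : ℝ)) - (((l₂ 1 : ℕ) : ℝ)) - (((l₃ 1 : ℕ) : ℝ)) + (((l₄ 1 : ℕ) : ℝ))) ↔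
        0 < ε * ((((l₁ 0 : ℕ) : ℝ)) - (((l₂ 0 : ℕ) : ℝ)) - (((l₃ 0 : ℕ) : ℝ)) + (((l₄ 0 : ℕ) : ℝ))) +
          lam' * ((((l₁ 1 : ℕ) : ℝ)) - (((l₂ 1 : ℕ) : ℝ)) - (((l₃ 1 : ℕ) : ℝ)) + (((l₄ 1 : ℕ) : ℝ)))))) :
    {a : Fin m → (Fin 2 →₀ ℕ) | ∃ lam ∈ Λ,
        Set.InjOn (fun b : Fin m → (Fin 2 →₀ ℕ) => ε * QuasiPoly.Xf b + lam * QuasiPoly.Yf b) (Fintype.piFinset A) ∧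
        a ∈ QuasiPoly.gE (Fintype.piFinset A) (QuasiPoly.col f)
          (fun b : Fin m → (Fin 2 →₀ ℕ) => ε * QuasiPoly.Xf b + lam * QuasiPoly.Yf b)}.ncard ≤
      (k * k + 3) * (8 * (k + 2) ^ 3) ^ Nat.clog 2 (k * k) := by
  classical
  -- letter heights and the set of cell words
  set lhf : ℝ → (Fin 2 →₀ ℕ) → ℝ := fun lam l => ε * ((l 0 : ℕ) : ℝ) + lam * ((l 1 : ℕ) : ℝ) with hlhf
  set W := {a : Fin m → (Fin 2 →₀ ℕ) | ∃ lam ∈ Λ,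
        Set.InjOn (fun b : Fin m → (Fin 2 →₀ ℕ) => ε * QuasiPoly.Xf b + lam * QuasiPoly.Yf b) (Fintype.piFinset A) ∧
        a ∈ QuasiPoly.gE (Fintype.piFinset A) (QuasiPoly.col f)
          (fun b : Fin m → (Fin 2 →₀ ℕ) => ε * QuasiPoly.Xf b + lam * QuasiPoly.Yf b)} with hW
  rcases Set.eq_empty_or_nonempty W with hWe | ⟨a₀, lam₀, hlam₀, hinj₀, ha₀⟩
  · rw [hWe, Set.ncard_empty]; exact Nat.zero_le _
  -- a reference parameter `lam₀`: the box is nonempty, so every alphabet is nonempty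
  have ha₀E : a₀ ∈ Fintype.piFinset A := ha₀.1
  have hAne : ∀ j, (A j).Nonempty := fun j => ⟨a₀ j, Fintype.mem_piFinset.mp ha₀E j⟩
  -- the letterwise top word at `lam₀`
  have hτex : ∀ j, ∃ τj ∈ A j, ∀ l ∈ A j, lhf lam₀ l ≤ lhf lam₀ τj := fun j =>
    Finset.exists_max_image (A j) (lhf lam₀) (hAne j)
  choose τ hτA hτ₀ using hτex
  -- transport of letter comparisons along the cell
  have hτ : ∀ lam ∈ Λ, ∀ j, ∀ l ∈ A j, lhf lam l ≤ lhf lam (τ j) := by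
    intro lam hlam j l hl
    have h := (hcell j j (τ j) (hτA j) l hl l hl l hl lam hlam lam₀ hlam₀).1
    have h0 : ¬ (ε * ((((τ j 0 : ℕ) : ℝ)) - (((l 0 : ℕ) : ℝ)) - (((l 0 : ℕ) : ℝ)) + (((l 0 : ℕ) : ℝ))) +
        lam₀ * ((((τ j 1 : ℕ) : ℝ)) - (((l 1 : ℕ) : ℝ)) - (((l 1 : ℕ) : ℝ)) + (((l 1 : ℕ) : ℝ))) < 0) := by
      have := hτ₀ j l hl
      simp only [hlhf] at this
      intro hlt
      linarith
    have h1 := mt h.mp h0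
    simp only [hlhf]
    linarith [not_lt.mp h1]
  -- weights and the transport of their order
  set wtf : ℝ → (Fin m × (Fin 2 →₀ ℕ)) → ℝ := fun lam d => lhf lam (τ d.1) - lhf lam d.2 with hwtf
  have hwt : ∀ lam ∈ Λ, ∀ d d' : Fin m × (Fin 2 →₀ ℕ), d.2 ∈ A d.1 → d'.2 ∈ A d'.1 →
      (wtf lam d' < wtf lam d ↔ wtf lam₀ d' < wtf lam₀ d) := by
    intro lam hlam d d' hd hd'
    have h := (hcell d.1 d'.1 (τ d.1) (hτA _) d.2 hd (τ d'.1) (hτA _) d'.2 hd' lam hlam lam₀ hlam₀).2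
    simp only [hwtf, hlhf]
    constructor
    · intro hlt
      have : 0 < ε * ((((τ d.1 0 : ℕ) : ℝ)) - (((d.2 0 : ℕ) : ℝ)) - (((τ d'.1 0 : ℕ) : ℝ)) + (((d'.2 0 : ℕ) : ℝ))) +
          lam * ((((τ d.1 1 : ℕ) : ℝ)) - (((d.2 1 : ℕ) : ℝ)) - (((τ d'.1 1 : ℕ) : ℝ)) + (((d'.2 1 : ℕ) : ℝ))) := by
        linarith
      have := h.mp this
      linarith
    · intro hlt
      have : 0 < ε * ((((τ d.1 0 : ℕ) : ℝ)) - (((d.2 0 : ℕ) : ℝ)) - (((τ d'.1 0 : ℕ) : ℝ)) + (((d'.2 0 : ℕ) : ℝ))) +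
          lam₀ * ((((τ d.1 1 : ℕ) : ℝ)) - (((d.2 1 : ℕ) : ℝ)) - (((τ d'.1 1 : ℕ) : ℝ)) + (((d'.2 1 : ℕ) : ℝ))) := by
        linarith
      have := h.mpr this
      linarith
  -- the demotions, their ratio vectors, weights (at `lam₀`) and colors
  set Dm : Finset (Fin m × (Fin 2 →₀ ℕ)) :=
    (Finset.univ ×ˢ Finset.univ.biUnion A).filter fun d => d.2 ∈ A d.1 ∧ d.2 ≠ τ d.1 with hDm
  have mem_Dm : ∀ d : Fin m × (Fin 2 →₀ ℕ), d ∈ Dm ↔ d.2 ∈ A d.1 ∧ d.2 ≠ τ d.1 := by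
    intro d
    simp only [hDm, Finset.mem_filter, Finset.mem_product, Finset.mem_univ, Finset.mem_biUnion, true_and]
    exact ⟨fun h => h.2, fun h => ⟨⟨d.1, h.1⟩, h⟩⟩
  set v : (Fin m × (Fin 2 →₀ ℕ)) → Fin k → ℂ := fun d i => (f i d.1).coeff d.2 / (f i d.1).coeff (τ d.1) with hv
  set w : (Fin m × (Fin 2 →₀ ℕ)) → ℝ := wtf lam₀ with hw
  -- weights are injective on the demotions (injectivity of the height at `lam₀`)
  have hwinj : Set.InjOn w Dm := by
    intro d hd d' hd' hdd
    rw [Finset.mem_coe, mem_Dm] at hd hd'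
    have hτE : τ ∈ Fintype.piFinset A := Fintype.mem_piFinset.mpr hτA
    have hbE : Function.update τ d.1 d.2 ∈ Fintype.piFinset A := by
      refine Fintype.mem_piFinset.mpr fun j => ?_
      by_cases hj : j = d.1
      · subst hj; simpa using hd.1
      · rw [Function.update_of_ne hj]; exact hτA j
    have hbE' : Function.update τ d'.1 d'.2 ∈ Fintype.piFinset A := by
      refine Fintype.mem_piFinset.mpr fun j => ?_
      by_cases hj : j = d'.1
      · subst hj; simpa using hd'.1
      · rw [Function.update_of_ne hj]; exact hτA j
    have hheq : ε * QuasiPoly.Xf (Function.update τ d.1 d.2) + lam₀ * QuasiPoly.Yf (Function.update τ d.1 d.2) =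
        ε * QuasiPoly.Xf (Function.update τ d'.1 d'.2) + lam₀ * QuasiPoly.Yf (Function.update τ d'.1 d'.2) := by
      rw [hgt_update, hgt_update]
      simp only [hw, hwtf, hlhf] at hdd
      linarith
    have hbb := hinj₀ hbE hbE' hheq
    by_cases h1 : d.1 = d'.1
    · have h2 : d.2 = d'.2 := by
        have := congrFun hbb d.1
        rw [Function.update_self, h1, Function.update_self] at this
        exact this
      exact Prod.ext h1 h2
    · have := congrFun hbb d.1
      rw [Function.update_self, Function.update_of_ne h1] at this
      exact absurd this hd.2
  -- the pool and its size
  set S : Set (Fin m × (Fin 2 →₀ ℕ)) := {d | d ∈ Dm ∧ ∃ J : Finset (Fin m), J.card ≤ k - 2 ∧ d.1 ∉ J ∧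
      v d ∉ Submodule.span ℂ (v '' {d' | d' ∈ Dm ∧ w d' < w d ∧ d'.1 ∉ J})} with hS
  have hSfin : S.Finite := Dm.finite_toSet.subset fun d hd => hd.1
  have hScard : S.ncard ≤ (k - 2 + 1) * k :=
    stub_coloredNovelty (Fin m × (Fin 2 →₀ ℕ)) (Fin m) k (k - 2) Dm v w Prod.fst (fun j : Fin m => ((j : ℕ) : ℂ))
      (fun j j' (h : ((j : ℕ) : ℂ) = ((j' : ℕ) : ℂ)) => Fin.ext (by exact_mod_cast h)) hwinj
  set poolF : Finset (Fin m × (Fin 2 →₀ ℕ)) := hSfin.toFinset with hpoolF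
  have mem_poolF : ∀ d, d ∈ poolF ↔ d ∈ S := fun d => Set.Finite.mem_toFinset hSfin
  have hpoolF_card : poolF.card ≤ k * k := by
    have h1 : poolF.card = S.ncard := (Set.ncard_eq_toFinset_card S hSfin).symm
    rw [h1]
    refine hScard.trans ?_
    rcases Nat.eq_zero_or_pos k with hk | hk
    · subst hk; simp
    · exact Nat.mul_le_mul_right k (by omega)
  -- every demotion of a greedy word of the cell is a pool element
  have hcontain : ∀ lam ∈ Λ, ∀ a : Fin m → (Fin 2 →₀ ℕ),
      Set.InjOn (fun b : Fin m → (Fin 2 →₀ ℕ) => ε * QuasiPoly.Xf b + lam * QuasiPoly.Yf b) (Fintype.piFinset A) →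
      a ∈ QuasiPoly.gE (Fintype.piFinset A) (QuasiPoly.col f)
        (fun b : Fin m → (Fin 2 →₀ ℕ) => ε * QuasiPoly.Xf b + lam * QuasiPoly.Yf b) →
      ∀ j, a j ≠ τ j → (j, a j) ∈ S := by
    intro lam hlam a hinj ha j hj
    have haE : ∀ j, a j ∈ A j := Fintype.mem_piFinset.mp ha.1
    have hdepth := stub_torusDepth k m A f ε lam τ a htorus hτA (hτ lam hlam) hinj ha
    have hcross := stub_torusCrossNovelty k m A f ε lam τ a j htorus hτA ha hj
    set D : Finset (Fin m) := Finset.univ.filter fun j' => a j' ≠ τ j' with hD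
    have hjD : j ∈ D := Finset.mem_filter.mpr ⟨Finset.mem_univ _, hj⟩
    refine ⟨(mem_Dm _).mpr ⟨haE j, hj⟩, D.erase j, ?_, Finset.notMem_erase j D, ?_⟩
    · have := Finset.card_erase_of_mem hjD
      omega
    · intro hmem
      apply hcross
      refine Submodule.span_mono (Set.image_mono ?_) hmem
      intro d' hd'
      obtain ⟨hd'Dm, hlt, hd'J⟩ := hd'
      rw [mem_Dm] at hd'Dm
      refine ⟨hd'Dm.1, hd'Dm.2, ?_, ?_⟩
      · have h := (hwt lam hlam (j, a j) d' (haE j) hd'Dm.1).mpr hlt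
        simpa [hwtf, hlhf] using h
      · by_cases h1 : d'.1 = j
        · exact Or.inl h1
        · right
          by_contra hne
          exact hd'J (Finset.mem_erase.mpr ⟨h1, Finset.mem_filter.mpr ⟨Finset.mem_univ _, hne⟩⟩)
  -- the coordinate set and the letter sets of the sub-box
  set P : Finset (Fin m) := poolF.image Prod.fst with hP
  set B : Fin m → Finset (Fin 2 →₀ ℕ) := fun j => insert (τ j) ((poolF.filter fun d => d.1 = j).image Prod.snd)
    with hB
  have hBA : ∀ j, B j ⊆ A j := by
    intro j l hl
    rcases Finset.mem_insert.mp hl with rfl | hl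
    · exact hτA j
    · obtain ⟨d, hd, rfl⟩ := Finset.mem_image.mp hl
      obtain ⟨hdpool, hdj⟩ := Finset.mem_filter.mp hd
      have hdS := (mem_poolF d).mp hdpool
      have := ((mem_Dm d).mp hdS.1).1
      rw [hdj] at this
      exact this
  have hτB : ∀ j, τ j ∈ B j := fun j => Finset.mem_insert_self _ _
  have hBcard : ∀ j, (B j).card ≤ k * k + 1 := by
    intro j
    calc (B j).card ≤ ((poolF.filter fun d => d.1 = j).image Prod.snd).card + 1 := Finset.card_insert_le _ _
      _ ≤ (poolF.filter fun d => d.1 = j).card + 1 := by gcongr; exact Finset.card_image_le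
      _ ≤ poolF.card + 1 := by gcongr; exact Finset.filter_subset _ _
      _ ≤ k * k + 1 := by gcongr
  have hwords : ∀ lam ∈ Λ, ∀ a : Fin m → (Fin 2 →₀ ℕ),
      Set.InjOn (fun b : Fin m → (Fin 2 →₀ ℕ) => ε * QuasiPoly.Xf b + lam * QuasiPoly.Yf b) (Fintype.piFinset A) →
      a ∈ QuasiPoly.gE (Fintype.piFinset A) (QuasiPoly.col f)
        (fun b : Fin m → (Fin 2 →₀ ℕ) => ε * QuasiPoly.Xf b + lam * QuasiPoly.Yf b) →
      (∀ j, j ∉ P → a j = τ j) ∧ (∀ j, a j ∈ B j) := by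
    intro lam hlam a hinj ha
    have key : ∀ j, a j ≠ τ j → (j, a j) ∈ poolF := fun j hj =>
      (mem_poolF _).mpr (hcontain lam hlam a hinj ha j hj)
    constructor
    · intro j hjP
      by_contra hne
      exact hjP (Finset.mem_image.mpr ⟨(j, a j), key j hne, rfl⟩)
    · intro j
      by_cases hja : a j = τ j
      · rw [hja]; exact hτB j
      · exact Finset.mem_insert_of_mem
          (Finset.mem_image.mpr ⟨(j, a j), Finset.mem_filter.mpr ⟨key j hja, rfl⟩, rfl⟩)
  -- the sub-frame count
  have hcount := stub_subframeCount k m (k * k + 1) A f ε Λ τ P B hBA hτB hBcard hwords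
  have hPcard : P.card ≤ k * k := Finset.card_image_le.trans hpoolF_card
  calc W.ncard ≤ (k * k + 1 + 2) * (8 * (k + 2) ^ 3) ^ Nat.clog 2 P.card := hcount
    _ ≤ (k * k + 3) * (8 * (k + 2) ^ 3) ^ Nat.clog 2 (k * k) := by
        have h1 : k * k + 1 + 2 = k * k + 3 := by ring
        rw [h1]
        exact Nat.mul_le_mul_left _ (Nat.pow_le_pow_right (by positivity) (Nat.clog_mono_right 2 hPcard))

end TorusLogK

/-- **Per-cell bound on torus frames** (export of `TorusLogK.perCell`, registered by-product stub `torus_perCell`):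
on a cell `Λ` of the chart `ε X + λ Y` the greedy words of a torus frame met at injective parameters number at most
`(k² + 3)(8(k+2)³)^⌈log₂ k²⌉`. -/
theorem torus_perCell (k m : ℕ) (A : Fin m → Finset (Fin 2 →₀ ℕ)) (f : Fin k → Fin m → MvPolynomial (Fin 2) ℂ) (htorus : ∀ i j, ∀ l ∈ A j, (f i j).coeff l ≠ 0) (ε : ℝ) (Λ : Set ℝ) (hcell : ∀ (j j' : Fin m), ∀ l₁ ∈ A j, ∀ l₂ ∈ A j, ∀ l₃ ∈ A j', ∀ l₄ ∈ A j', ∀ lam ∈ Λ, ∀ lam' ∈ Λ, ((ε * ((((l₁ 0 : ℕ) : ℝ)) - (((l₂ 0 : ℕ) : ℝ)) - (((l₃ 0 : ℕ) : ℝ)) + (((l₄ 0 : ℕ) : ℝ))) + lam * ((((l₁ 1 : ℕ) : ℝ)) - (((l₂ 1 : ℕ) : ℝ)) - (((l₃ 1 : ℕ) : ℝ)) + (((l₄ 1 : ℕ) : ℝ))) < 0 ↔ ε * ((((l₁ 0 : ℕ) : ℝ)) - (((l₂ 0 : ℕ) : ℝ)) - (((l₃ 0 : ℕ) : ℝ))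 + (((l₄ 0 : ℕ) : ℝ))) + lam' * ((((l₁ 1 : ℕ) : ℝ)) - (((l₂ 1 : ℕ) : ℝ)) - (((l₃ 1 : ℕ) : ℝ)) + (((l₄ 1 : ℕ) : ℝ))) < 0) ∧ (0 < ε * ((((l₁ 0 : ℕ) : ℝ)) - (((l₂ 0 : ℕ) : ℝ)) - (((l₃ 0 : ℕ) : ℝ)) + (((l₄ 0 : ℕ) : ℝ))) + lam * ((((l₁ 1 : ℕ) : ℝ)) - (((l₂ 1 : ℕ) : ℝ)) - (((l₃ 1 : ℕ) : ℝ)) + (((l₄ 1 : ℕ) : ℝ))) ↔ 0 < ε * ((((l₁ 0 : ℕ) : ℝ)) - (((l₂ 0 : ℕ) : ℝ)) - (((l₃ 0 : ℕ) : ℝ)) + (((l₄ 0 : ℕ) : ℝ))) + lam' * ((((l₁ 1 : ℕ) : ℝ)) - (((l₂ 1 : ℕ) : ℝ)) - (((l₃ 1 : ℕ) : ℝ)) + (((l₄ 1 : ℕ) : ℝ)))))) : {a : Fin m → (Fin 2 →₀ ℕ) | ∃ lam ∈ Λ, Set.InjOn (fun b : Fin m → (Fin 2 →₀ ℕ) =>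 ε * QuasiPoly.Xf b + lam * QuasiPoly.Yf b) (Fintype.piFinset A) ∧ a ∈ QuasiPoly.gE (Fintype.piFinset A) (QuasiPoly.col f) (fun b : Fin m → (Fin 2 →₀ ℕ) => ε * QuasiPoly.Xf b + lam * QuasiPoly.Yf b)}.ncard ≤ (k * k + 3) * (8 * (k + 2) ^ 3) ^ Nat.clog 2 (k * k) :=
  TorusLogK.perCell k m A f htorus ε Λ hcell

end Summit.ValiantsHypothesis.ValiantsHypothesis.Theorems.NewtonUnitEquationsDissociatedUniform

end
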